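import Summits.Ventures.DiscreteObjects.PP12.FlagTenOrbitDataOfPlane

/-!
# The `f = 10` flag-cell orbit data: the fibres of `γ` have size 3 (kernel; Step C, conjunct 2 of `IsFlagTenOrbitMatrix` before transport)
Framing: lottery ticket; floor = certified bounds/negative ranges.

Cell pub-namedobj (venture DiscreteObjects), target (M), designs gen 13 (HOME FAMILY-FLAG7X §7, Step C). Setting as in `FlagTenOrbitDataOfPlane`
(order 12, flag type, `σ³ = 1`, ten fixed points, a non-fixed line `u₀ ∋ c`). For a fixed line `m ≠ l` and one of the four orbits `S` of its
points `≠ c`, the triangles (indexed by the points `x ≠ c` of `u₀`) whose side orbit meets `m` inside `S` are in bijection with the exterior lines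
through any fixed `w₀ ∈ S` (a line is a side of at most one triangle; through `w₀` pass exactly `13 − f = 3` exterior lines,
`FlagPencilCensus.card_exterior_lines_through_off_l`):
* `side_orbit_line_through` — if `w' ∈ orb3 (sideOf x ∩ m)` then exactly one line of the side orbit `orb3 (sideOf x)` passes through `w'`;
* **`card_gammaOrb_fibre`** — `#{x ∈ u₀, x ≠ c : gammaOrb m x = S} = 3`;
* **`card_cOrb_fibre`** — dually for `C`: `#{x ∈ u₀, x ≠ c : cOrb y x = orb3 b} = 3` for a T-line `b ∋ y` (conjunct 3).
(The separation half of conjunct 2, `gammaOrb_phiVertex_ne`, is in `FlagTenGammaSeparates`.)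
No `sorry`, no new axioms.
-/

namespace Summit.Ventures.DiscreteObjects.PP12

open Configuration Finset
open scoped Classical

namespace Collineation

variable {P L : Type*} [Membership P L] [ProjectivePlane P L] [Fintype P] [Fintype L] (σ : Collineation P L)

section Flag

variable {l : L} {c : P} (hl : σ.onLines l = l) (hc : σ.onPoints c = c) (hcl : c ∈ l)
  (hP : ∀ p : P, σ.onPoints p = p → p ∈ l) (hL : ∀ m : L, σ.onLines m = m → c ∈ m)
  (h12 : ProjectivePlane.order P L = 12)

omit [Fintype P] [Fintype L] in
/-- The image of a meeting point: `σ (a ∩ m) = σa ∩ m` for a fixed line `m` (as a membership statement). -/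
theorem map_meetPt_mem {m : L} (hm : σ.onLines m = m) {a : L} (ham : a ≠ m) :
    σ.onPoints (meetPt c a m) ∈ σ.onLines a ∧ σ.onPoints (meetPt c a m) ∈ m :=
  ⟨σ.mem_map (meetPt_spec c ham).1, (σ.mem_fixedLine_iff hm _).2 (meetPt_spec c ham).2⟩

/-- **Exactly one line of a side orbit through each point of the orbit of its point on `m`.** Let `a` be a non-fixed line, `m` a fixed line,
`a ≠ m`, `w = a ∩ m` not fixed, and `w' ∈ orb3 w`. Then some line of `orb3 a` passes through `w'`, and at most one does. -/
theorem side_orbit_line_through (hq : σ.onPoints ^ 3 = 1) {m : L} (hm : σ.onLines m = m) {a : L} (ham : a ≠ m)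
    (hw : σ.onPoints (meetPt c a m) ≠ meetPt c a m) {w' : P} (hw' : w' ∈ orb3 σ.onPoints (meetPt c a m)) :
    (∃ a' ∈ orb3 σ.onLines a, w' ∈ a') ∧ ((orb3 σ.onLines a).filter fun a' => w' ∈ a').card ≤ 1 := by
  have hqL : σ.onLines ^ 3 = 1 := σ.onLines_pow_eq_one hq
  obtain ⟨hwa, hwm⟩ := meetPt_spec c ham
  have hw'm : w' ∈ m := by
    rw [mem_orb3] at hw'
    rcases hw' with rfl | rfl | rfl
    · exact hwm
    · exact (σ.mem_fixedLine_iff hm _).2 hwm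
    · exact (σ.mem_fixedLine_iff hm _).2 ((σ.mem_fixedLine_iff hm _).2 hwm)
  have hw'f : σ.onPoints w' ≠ w' := by
    rw [mem_orb3] at hw'
    rcases hw' with rfl | rfl | rfl
    · exact hw
    · exact fun e => hw (σ.onPoints.injective e)
    · exact fun e => hw (σ.onPoints.injective (σ.onPoints.injective e))
  refine ⟨?_, ?_⟩
  · rw [mem_orb3] at hw'
    rcases hw' with rfl | rfl | rfl
    · exact ⟨a, self_mem_orb3 _ _, hwa⟩
    · exact ⟨σ.onLines a, (mem_orb3 _ _ _).2 (Or.inr (Or.inl rfl)), σ.mem_map hwa⟩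
    · exact ⟨σ.onLines (σ.onLines a), (mem_orb3 _ _ _).2 (Or.inr (Or.inr rfl)), σ.mem_map (σ.mem_map hwa)⟩
  · -- dual of `card_orb3_inter_le_one_of_fixed_mem`: w' is a non-fixed point ON the fixed line m
    exact σ.dual.card_orb3_inter_le_one_of_fixed_mem (a := (w' : Dual P)) (y := (m : Dual L)) hqL hw'f hm hw'm a

include hl hc hcl hP hL h12 in
/-- **The fibres of `γ` have three elements** (`f = 10`): for a fixed line `m ≠ l`, a non-fixed `u₀ ∋ c` and an orbit `S` of points `≠ c` of `m`,
exactly three of the triangles indexed by the points `x ≠ c` of `u₀` have `gammaOrb m x = S`. -/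
theorem card_gammaOrb_fibre (hq : σ.onPoints ^ 3 = 1) (hf : fixedCard σ.onPoints = 10) {u₀ : L} (hcu₀ : c ∈ u₀) (hu₀ : σ.onLines u₀ ≠ u₀)
    {m : L} (hm : σ.onLines m = m) (hml : m ≠ l) {S : Finset P}
    (hS : S ∈ (univ.filter fun p : P => p ∈ m ∧ p ≠ c).image (orb3 σ.onPoints)) :
    (univ.filter fun x : P => x ∈ u₀ ∧ x ≠ c ∧ σ.gammaOrb l c m x = S).card = 3 := by
  have hqL : σ.onLines ^ 3 = 1 := σ.onLines_pow_eq_one hq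
  -- a base point w₀ ∈ S: non-fixed, on m, not c, not on l
  obtain ⟨w₀, hw₀, rfl⟩ := mem_image.1 hS
  rw [mem_filter] at hw₀
  obtain ⟨-, hw₀m, hw₀c⟩ := hw₀
  have hw₀f : σ.onPoints w₀ ≠ w₀ := fun e => hw₀c ((Nondegenerate.eq_or_eq hw₀m (hL m hm) (hP w₀ e) hcl).resolve_right hml)
  have hw₀l : w₀ ∉ l := fun h => hw₀c ((Nondegenerate.eq_or_eq hw₀m (hL m hm) h hcl).resolve_right hml)
  -- the target set: exterior lines through w₀ (three of them)
  set E : Finset L := univ.filter fun e : L => w₀ ∈ e ∧ ∀ p : P, σ.onPoints p = p → p ∉ e with hE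
  have hE3 : E.card = 3 := by rw [hE, σ.card_exterior_lines_through_off_l hP h12 hw₀f hw₀l, hf]
  set F : Finset P := univ.filter fun x : P => x ∈ u₀ ∧ x ≠ c ∧ σ.gammaOrb l c m x = orb3 σ.onPoints w₀ with hF
  -- facts about a member x of the fibre
  have memF : ∀ x ∈ F, (∀ m' : L, σ.onLines m' = m' → x ∉ m') ∧ σ.onPoints x ≠ x ∧ x ∈ σ.sideOf l x ∧ σ.onPoints x ∈ σ.sideOf l x ∧
      (∀ p : P, σ.onPoints p = p → p ∉ σ.sideOf l x) ∧ σ.sideOf l x ≠ m ∧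
      σ.onPoints (meetPt c (σ.sideOf l x) m) ≠ meetPt c (σ.sideOf l x) m ∧ w₀ ∈ orb3 σ.onPoints (meetPt c (σ.sideOf l x) m) := by
    intro x hx
    rw [hF, mem_filter] at hx
    obtain ⟨-, hxu, hxc, hγ⟩ := hx
    have hxX := σ.exterior_of_mem_cline hL hcu₀ hu₀ hxu hxc
    have hxf : σ.onPoints x ≠ x := σ.not_fixed_of_exterior_flag hl hP hxX
    obtain ⟨hxa, hσxa⟩ := σ.sideOf_spec l hxf
    have ha0 : ∀ p : P, σ.onPoints p = p → p ∉ σ.sideOf l x := (σ.side_no_fixed_point hxf hxX hxa hσxa).2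
    have ham : σ.sideOf l x ≠ m := fun e => ha0 c hc (e ▸ hL m hm)
    obtain ⟨-, -, -, hwf⟩ := σ.gammaOrb_mem hl hc hP hL hxX hm
    refine ⟨hxX, hxf, hxa, hσxa, ha0, ham, hwf, ?_⟩
    change orb3 σ.onPoints (meetPt c (σ.sideOf l x) m) = orb3 σ.onPoints w₀ at hγ
    rw [hγ]; exact self_mem_orb3 _ _
  -- the map: x ↦ the line of its side orbit through w₀
  let Φ : P → L := fun x => if h : ((orb3 σ.onLines (σ.sideOf l x)).filter fun a' => w₀ ∈ a').Nonempty then h.choose else l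
  have hΦ : ∀ x ∈ F, Φ x ∈ orb3 σ.onLines (σ.sideOf l x) ∧ w₀ ∈ Φ x := by
    intro x hx
    obtain ⟨-, -, -, -, -, ham, hwf, hw₀o⟩ := memF x hx
    obtain ⟨⟨a', ha', hw₀a'⟩, -⟩ := σ.side_orbit_line_through (c := c) hq hm ham hwf hw₀o
    have hne : ((orb3 σ.onLines (σ.sideOf l x)).filter fun a' => w₀ ∈ a').Nonempty := ⟨a', mem_filter.2 ⟨ha', hw₀a'⟩⟩
    have : Φ x = hne.choose := by simp only [Φ, dif_pos hne]
    rw [this]; exact mem_filter.1 hne.choose_spec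
  -- lines of a side orbit are sides: Φ x contains σ^e x and σ^(e+1) x for some e, hence is an exterior line and determines the triangle
  have side_of_orbit : ∀ x ∈ F, ∀ a' ∈ orb3 σ.onLines (σ.sideOf l x),
      ∃ Q ∈ orb3 σ.onPoints x, Q ∈ a' ∧ σ.onPoints Q ∈ a' ∧ (∀ m' : L, σ.onLines m' = m' → Q ∉ m') := by
    intro x hx a' ha'
    obtain ⟨hxX, hxf, hxa, hσxa, -, -, -, -⟩ := memF x hx
    rw [mem_orb3] at ha'
    rcases ha' with rfl | rfl | rfl
    · exact ⟨x, self_mem_orb3 _ _, hxa, hσxa, hxX⟩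
    · exact ⟨σ.onPoints x, (mem_orb3 _ _ _).2 (Or.inr (Or.inl rfl)), σ.mem_map hxa, σ.mem_map hσxa, σ.exterior_map hxX⟩
    · exact ⟨σ.onPoints (σ.onPoints x), (mem_orb3 _ _ _).2 (Or.inr (Or.inr rfl)), σ.mem_map (σ.mem_map hxa),
        σ.mem_map (σ.mem_map hσxa), σ.exterior_map (σ.exterior_map hxX)⟩
  have hΦE : ∀ x ∈ F, Φ x ∈ E := by
    intro x hx
    obtain ⟨hΦo, hw₀Φ⟩ := hΦ x hx
    obtain ⟨Q, -, hQa, hσQa, hQX⟩ := side_of_orbit x hx _ hΦo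
    have hQf : σ.onPoints Q ≠ Q := σ.not_fixed_of_exterior_flag hl hP hQX
    rw [hE, mem_filter]
    exact ⟨mem_univ _, hw₀Φ, (σ.side_no_fixed_point hQf hQX hQa hσQa).2⟩
  -- injectivity: a common line of two side orbits forces the same triangle, and a triangle has one vertex on u₀
  have hΦinj : ∀ x ∈ F, ∀ x' ∈ F, Φ x = Φ x' → x = x' := by
    intro x hx x' hx' heq
    obtain ⟨Q, hQx, hQa, hσQa, hQX⟩ := side_of_orbit x hx _ (hΦ x hx).1
    obtain ⟨Q', hQ'x', hQ'a, hσQ'a, -⟩ := side_of_orbit x' hx' _ (hΦ x' hx').1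
    rw [← heq] at hQ'a hσQ'a
    have hQQ' : Q' = Q := σ.side_unique hQX hQa hσQa hQ'a hσQ'a
    -- x' ∈ orb3 x (both orbits contain Q = Q'), and both lie on u₀
    have horb : orb3 σ.onPoints x' = orb3 σ.onPoints x := by
      rw [← orb3_eq_of_mem σ.onPoints hq hQ'x', hQQ', orb3_eq_of_mem σ.onPoints hq hQx]
    have hx'o : x' ∈ orb3 σ.onPoints x := by rw [← horb]; exact self_mem_orb3 _ _
    have hxu : x ∈ u₀ := (mem_filter.1 hx).2.1
    have hx'u : x' ∈ u₀ := (mem_filter.1 hx').2.1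
    -- at most one point of orb3 x on the non-fixed c-line u₀
    have hle := σ.card_orb3_inter_cline_le_one hc hq hcu₀ hu₀ x
    by_contra hne
    have h2 : 2 ≤ ((orb3 σ.onPoints x).filter fun q => q ∈ u₀).card := by
      have hsub : ({x, x'} : Finset P) ⊆ (orb3 σ.onPoints x).filter fun q => q ∈ u₀ := by
        intro z hz; rw [mem_insert, mem_singleton] at hz; rw [mem_filter]
        rcases hz with rfl | rfl
        · exact ⟨self_mem_orb3 _ _, hxu⟩
        · exact ⟨hx'o, hx'u⟩
      have := card_le_card hsub; rwa [card_pair hne] at this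
    omega
  -- surjectivity: every exterior line through w₀ is a side of a triangle with a vertex on u₀, in the fibre
  have hΦsurj : ∀ e ∈ E, ∃ x ∈ F, Φ x = e := by
    intro e he
    rw [hE, mem_filter] at he
    obtain ⟨-, hw₀e, he0⟩ := he
    have hne : σ.onLines e ≠ e := fun h => he0 c hc (h ▸ hL e h)
    obtain ⟨Q, hQ, hQe, hσQe⟩ := σ.exterior_line_is_side hl hc hcl hP hL hne he0
    obtain ⟨x, hxQ, hxu⟩ := σ.exterior_orbit_meets_cline hl hc hcl hL h12 hq hf hcu₀ hu₀ hQ.2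
    -- x is exterior, x ≠ c
    have hxX : ∀ m' : L, σ.onLines m' = m' → x ∉ m' := by
      rw [mem_orb3] at hxQ
      rcases hxQ with rfl | rfl | rfl
      · exact hQ.2
      · exact σ.exterior_map hQ.2
      · exact σ.exterior_map (σ.exterior_map hQ.2)
    have hxc : x ≠ c := fun e => hxX l hl (e ▸ hcl)
    have hxf : σ.onPoints x ≠ x := σ.not_fixed_of_exterior_flag hl hP hxX
    obtain ⟨hxa, hσxa⟩ := σ.sideOf_spec l hxf
    -- e lies in the orbit of sideOf x: sideOf x = σ^k e where x = σ^k Q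
    have h3 := apply_three σ.onPoints hq Q
    have h3L := apply_three σ.onLines hqL e
    have heo : e ∈ orb3 σ.onLines (σ.sideOf l x) := by
      -- identify sideOf x with the appropriate image of e via two of its points
      rw [mem_orb3] at hxQ
      have key : ∀ (k : L), x ∈ k → σ.onPoints x ∈ k → k = σ.sideOf l x := fun k h1 h2 =>
        (Nondegenerate.eq_or_eq h1 h2 hxa hσxa).resolve_left hxf.symm
      rcases hxQ with rfl | rfl | rfl
      · rw [← key e hQe hσQe]; exact self_mem_orb3 _ _
      · -- x = σQ: σe ∋ σQ, σ²Q
        have : σ.onLines e = σ.sideOf l (σ.onPoints Q) := key _ (σ.mem_map hQe) (σ.mem_map hσQe)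
        rw [mem_orb3]; right; right
        -- e = σ²(σ e) = σ²(sideOf x)
        rw [← this, h3L]
      · -- x = σ²Q: σ²e ∋ σ²Q, σ³Q = Q
        have hm1 : σ.onPoints (σ.onPoints Q) ∈ σ.onLines (σ.onLines e) := σ.mem_map (σ.mem_map hQe)
        have hm2 : σ.onPoints (σ.onPoints (σ.onPoints Q)) ∈ σ.onLines (σ.onLines e) := σ.mem_map (σ.mem_map hσQe)
        have : σ.onLines (σ.onLines e) = σ.sideOf l (σ.onPoints (σ.onPoints Q)) := key _ hm1 hm2
        rw [mem_orb3]; right; left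
        rw [← this, h3L]
    -- x is in the fibre: gammaOrb m x = orb3 w₀
    have ha0 : ∀ p : P, σ.onPoints p = p → p ∉ σ.sideOf l x := (σ.side_no_fixed_point hxf hxX hxa hσxa).2
    have ham : σ.sideOf l x ≠ m := fun e' => ha0 c hc (e' ▸ hL m hm)
    have hem : e ≠ m := fun e' => he0 c hc (e' ▸ hL m hm)
    have hw₀eq : w₀ = meetPt c e m := meetPt_eq c hem hw₀e hw₀m
    have hγ : σ.gammaOrb l c m x = orb3 σ.onPoints w₀ := by
      -- the orbit on m of (sideOf x ∩ m) equals that of (e ∩ m) since e ∈ orb3 (sideOf x)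
      change orb3 σ.onPoints (meetPt c (σ.sideOf l x) m) = orb3 σ.onPoints w₀
      have hcx : c ∉ σ.sideOf l x := fun h => ha0 c hc h
      have := σ.betaOrb_eq hc hL hq hm hcx heo
      rw [σ.betaOrb_eq hc hL hq hm hcx (self_mem_orb3 _ _)] at this
      rw [this, ← hw₀eq]
    have hxF : x ∈ F := by rw [hF, mem_filter]; exact ⟨mem_univ _, hxu, hxc, hγ⟩
    refine ⟨x, hxF, ?_⟩
    -- Φ x is the unique line of orb3 (sideOf x) through w₀, and e is such a line
    obtain ⟨hΦo, hw₀Φ⟩ := hΦ x hxF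
    obtain ⟨-, -, -, -, -, -, hwf, hw₀o⟩ := memF x hxF
    have hle := (σ.side_orbit_line_through (c := c) hq hm ham hwf hw₀o).2
    by_contra hne'
    have h2 : 2 ≤ ((orb3 σ.onLines (σ.sideOf l x)).filter fun a' => w₀ ∈ a').card := by
      have hsub : ({Φ x, e} : Finset L) ⊆ (orb3 σ.onLines (σ.sideOf l x)).filter fun a' => w₀ ∈ a' := by
        intro z hz; rw [mem_insert, mem_singleton] at hz; rw [mem_filter]
        rcases hz with rfl | rfl
        · exact ⟨hΦo, hw₀Φ⟩
        · exact ⟨heo, hw₀e⟩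
      have := card_le_card hsub; rwa [card_pair hne'] at this
    omega
  -- conclude by the bijection
  rw [← hE3]
  exact Finset.card_bij (fun x _ => Φ x) hΦE hΦinj (fun e he => by obtain ⟨x, hx, hxe⟩ := hΦsurj e he; exact ⟨x, hx, hxe⟩)

include hl hc hcl hP hL h12 in
/-- **The fibres of `C` have three elements** (`f = 10`): for a fixed point `y ≠ c`, a non-fixed `u₀ ∋ c` and a line `b ≠ l` through `y`,
exactly three of the triangles indexed by the points `x ≠ c` of `u₀` have `cOrb y x = orb3 b` — they correspond to the three exterior points of
`b` (`FlagPencilCensus.card_exterior_points_on_tline`; a T-line meets every orbit at most once). -/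
theorem card_cOrb_fibre (hq : σ.onPoints ^ 3 = 1) (hf : fixedCard σ.onPoints = 10) {u₀ : L} (hcu₀ : c ∈ u₀) (hu₀ : σ.onLines u₀ ≠ u₀)
    {y : P} (hy : σ.onPoints y = y) (hyc : y ≠ c) {b : L} (hyb : y ∈ b) (hbl : b ≠ l) :
    (univ.filter fun x : P => x ∈ u₀ ∧ x ≠ c ∧ σ.cOrb l y x = orb3 σ.onLines b).card = 3 := by
  have hqL : σ.onLines ^ 3 = 1 := σ.onLines_pow_eq_one hq
  set E : Finset P := univ.filter fun Q : P => Q ∈ b ∧ ∀ m : L, σ.onLines m = m → Q ∉ m with hE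
  have hE3 : E.card = 3 := by rw [hE, σ.card_exterior_points_on_tline hcl hP hL h12 hy hyc hyb hbl, hf]
  set F : Finset P := univ.filter fun x : P => x ∈ u₀ ∧ x ≠ c ∧ σ.cOrb l y x = orb3 σ.onLines b with hF
  have hyσ : ∀ e : L, y ∈ e → y ∈ σ.onLines e := fun e he => by have := σ.mem_map he; rwa [hy] at this
  -- members of the fibre: exterior, and some point of their orbit lies on b
  have memF : ∀ x ∈ F, (∀ m' : L, σ.onLines m' = m' → x ∉ m') ∧ x ∈ u₀ ∧ ∃ Q ∈ orb3 σ.onPoints x, Q ∈ b := by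
    intro x hx
    rw [hF, mem_filter] at hx
    obtain ⟨-, hxu, hxc, hC⟩ := hx
    have hxX := σ.exterior_of_mem_cline hL hcu₀ hu₀ hxu hxc
    obtain ⟨-, hxk, -⟩ := σ.cOrb_mem hl hP hxX hy
    change orb3 σ.onLines (lineThrough l x y) = orb3 σ.onLines b at hC
    have hbk : b ∈ orb3 σ.onLines (lineThrough l x y) := by rw [hC]; exact self_mem_orb3 _ _
    refine ⟨hxX, hxu, ?_⟩
    rw [mem_orb3] at hbk
    rcases hbk with e | e | e
    · exact ⟨x, self_mem_orb3 _ _, by rw [e]; exact hxk⟩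
    · exact ⟨σ.onPoints x, (mem_orb3 _ _ _).2 (Or.inr (Or.inl rfl)), by rw [e]; exact σ.mem_map hxk⟩
    · exact ⟨σ.onPoints (σ.onPoints x), (mem_orb3 _ _ _).2 (Or.inr (Or.inr rfl)), by rw [e]; exact σ.mem_map (σ.mem_map hxk)⟩
  have hb1 : ∀ q : P, ((orb3 σ.onPoints q).filter fun q' => q' ∈ b).card ≤ 1 := σ.tline_orbit_simple hcl hP hL hq hy hyc hyb hbl
  let Ψ : P → P := fun x => if h : ((orb3 σ.onPoints x).filter fun q => q ∈ b).Nonempty then h.choose else c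
  have hΨ : ∀ x ∈ F, Ψ x ∈ orb3 σ.onPoints x ∧ Ψ x ∈ b := by
    intro x hx
    obtain ⟨-, -, Q, hQ, hQb⟩ := memF x hx
    have hne : ((orb3 σ.onPoints x).filter fun q => q ∈ b).Nonempty := ⟨Q, mem_filter.2 ⟨hQ, hQb⟩⟩
    have : Ψ x = hne.choose := by simp only [Ψ, dif_pos hne]
    rw [this]; exact mem_filter.1 hne.choose_spec
  have hΨE : ∀ x ∈ F, Ψ x ∈ E := by
    intro x hx
    obtain ⟨hxX, -, -⟩ := memF x hx
    obtain ⟨hΨo, hΨb⟩ := hΨ x hx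
    rw [hE, mem_filter]
    refine ⟨mem_univ _, hΨb, ?_⟩
    rw [mem_orb3] at hΨo
    rcases hΨo with e | e | e
    · rw [e]; exact hxX
    · rw [e]; exact σ.exterior_map hxX
    · rw [e]; exact σ.exterior_map (σ.exterior_map hxX)
  have hΨinj : ∀ x ∈ F, ∀ x' ∈ F, Ψ x = Ψ x' → x = x' := by
    intro x hx x' hx' heq
    obtain ⟨hΨo, -⟩ := hΨ x hx
    obtain ⟨hΨo', -⟩ := hΨ x' hx'
    rw [← heq] at hΨo'
    have horb : orb3 σ.onPoints x' = orb3 σ.onPoints x := by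
      rw [← orb3_eq_of_mem σ.onPoints hq hΨo', orb3_eq_of_mem σ.onPoints hq hΨo]
    have hx'o : x' ∈ orb3 σ.onPoints x := by rw [← horb]; exact self_mem_orb3 _ _
    have hxu : x ∈ u₀ := (mem_filter.1 hx).2.1
    have hx'u : x' ∈ u₀ := (mem_filter.1 hx').2.1
    have hle := σ.card_orb3_inter_cline_le_one hc hq hcu₀ hu₀ x
    by_contra hne
    have h2 : 2 ≤ ((orb3 σ.onPoints x).filter fun q => q ∈ u₀).card := by
      have hsub : ({x, x'} : Finset P) ⊆ (orb3 σ.onPoints x).filter fun q => q ∈ u₀ := by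
        intro z hz; rw [mem_insert, mem_singleton] at hz; rw [mem_filter]
        rcases hz with rfl | rfl
        · exact ⟨self_mem_orb3 _ _, hxu⟩
        · exact ⟨hx'o, hx'u⟩
      have := card_le_card hsub; rwa [card_pair hne] at this
    omega
  have hΨsurj : ∀ Q ∈ E, ∃ x ∈ F, Ψ x = Q := by
    intro Q hQ
    rw [hE, mem_filter] at hQ
    obtain ⟨-, hQb, hQX⟩ := hQ
    obtain ⟨x, hxQ, hxu⟩ := σ.exterior_orbit_meets_cline hl hc hcl hL h12 hq hf hcu₀ hu₀ hQX
    have hxX : ∀ m' : L, σ.onLines m' = m' → x ∉ m' := by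
      rw [mem_orb3] at hxQ
      rcases hxQ with e | e | e
      · rw [e]; exact hQX
      · rw [e]; exact σ.exterior_map hQX
      · rw [e]; exact σ.exterior_map (σ.exterior_map hQX)
    have hxc : x ≠ c := fun e => hxX l hl (e ▸ hcl)
    obtain ⟨-, hxk, hyk⟩ := σ.cOrb_mem hl hP hxX hy
    -- the line x·y is an image of b = Q·y under a power of σ
    have hC : σ.cOrb l y x = orb3 σ.onLines b := by
      change orb3 σ.onLines (lineThrough l x y) = orb3 σ.onLines b
      apply orb3_eq_of_mem σ.onLines hqL
      -- the line x·y is b, σb or σ²b according to x = Q, σQ, σ²Q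
      have hxy : x ≠ y := fun e' => (σ.not_fixed_of_exterior_flag hl hP hxX) (by rw [e', hy])
      have hk : ∀ k' : L, x ∈ k' → y ∈ k' → k' = lineThrough l x y := fun k' h1 h2 =>
        (Nondegenerate.eq_or_eq h1 h2 hxk hyk).resolve_left hxy
      rw [mem_orb3] at hxQ ⊢
      rcases hxQ with e | e | e
      · left; exact (hk b (by rw [e]; exact hQb) hyb).symm
      · right; left; exact (hk _ (by rw [e]; exact σ.mem_map hQb) (hyσ _ hyb)).symm
      · right; right; exact (hk _ (by rw [e]; exact σ.mem_map (σ.mem_map hQb)) (hyσ _ (hyσ _ hyb))).symm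
    have hxF : x ∈ F := by rw [hF, mem_filter]; exact ⟨mem_univ _, hxu, hxc, hC⟩
    refine ⟨x, hxF, ?_⟩
    obtain ⟨hΨo, hΨb⟩ := hΨ x hxF
    -- Ψ x and Q are both points of orb3 x (= orb3 Q) on b
    have hQo : Q ∈ orb3 σ.onPoints x := by rw [orb3_eq_of_mem σ.onPoints hq hxQ]; exact self_mem_orb3 _ _
    by_contra hne'
    have h2 : 2 ≤ ((orb3 σ.onPoints x).filter fun q => q ∈ b).card := by
      have hsub : ({Ψ x, Q} : Finset P) ⊆ (orb3 σ.onPoints x).filter fun q => q ∈ b := by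
        intro z hz; rw [mem_insert, mem_singleton] at hz; rw [mem_filter]
        rcases hz with rfl | rfl
        · exact ⟨hΨo, hΨb⟩
        · exact ⟨hQo, hQb⟩
      have := card_le_card hsub; rwa [card_pair hne'] at this
    have := hb1 x; omega
  rw [← hE3]
  exact Finset.card_bij (fun x _ => Ψ x) hΨE hΨinj (fun Q hQ => by obtain ⟨x, hx, hxe⟩ := hΨsurj Q hQ; exact ⟨x, hx, hxe⟩)

end Flag

end Collineation

end Summit.Ventures.DiscreteObjects.PP12
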